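import Literature.NumberTheory.EllipticCurves.SUnitMordellCurveConstructions
import Literature.NumberTheory.DiophantineGeometry.SUnitMordellHeightBoundsModularityProofs
import Mathlib.Algebra.BigOperators.Associated
import HarnessLib

/-!
# von Känel–Matschke, Prop. 10.1 (Mordell height bound `Ω_sim`) from Lemma 10.3 and Prop. 10.8 —
# the printed proof of §10.3, in kernel; with (eq:nuineq) `ν(m) ≤ ν(n)` for `m ∣ n`

Topic `Literature/NumberTheory/DiophantineGeometry` (family `abc`, LADDER-ABC A1: the *modular method*).
Theorems only — NO new statement (D-0026). von Känel–Matschke, arXiv:1605.06079 = Mem. AMS **286**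
(2023) no. 1419 [`VonkanelMatschke2023`], §10.3 (arXiv numbering), "Proof of Proposition 10.1":
"Lemma 10.3 provides an elliptic curve `E` over `ℚ` such that `N_E ∣ a_S` and such that
`max(h(x), (2/3)h(y)) ≤ (1/3)h(a) + 8h(E) + 2 log max(1, h(E)) + 36`. It follows from (eq:nuineq) that
`ν(N_E) ≤ (2/3) a_S`. Therefore on combining the displayed inequality with the explicit bound for `h(E)` in
terms of `ν(N_E)` given in Proposition 10.8 (ii), we deduce … Proposition 10.1."

* `condNu_mono_of_dvd` — **(eq:nuineq) PROVED**: `ν(m) ≤ ν(n)` for `m ∣ n` (`n ≠ 0`), where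
  `ν(n) = n ∏_{p² ∣ n}(1 − p⁻²)` is `condNu` ("this inequality directly follows by unwinding the
  definitions and by taking into account rational primes `p` with `ord_p(m) = 1` and `ord_p(n) ≥ 2`").
* `mordell_height_le_of_lemma_10_3` — **the named fact `mordell_height_le` (Prop. 10.1) follows from
  `vonKanelMatschke_lemma_10_3` and `vonKanelMatschke_prop_10_8_i`, `_ii`**, granted modularity with an
  integral Manin constant (`nonempty_modularParametrizationData`: the datum of `E` at level `N_E`, needed to
  read Prop. 10.8 (i) in the tree's phrasing, and `N_E ≥ 11`). Kernel bookkeeping: `a_S ≥ 1728`,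
  `36 ∣ a_S` so `ν(a_S) ≤ (2/3) a_S` (`condNu_le_two_thirds`); `8h(E) ≤ 4κ + (4/9) a_S log a_S +
  (1/6) a_S log₃ a_S + (8/27) a_S`; `2 log max(1, h(E)) + 36 + 4κ ≤ 4 log a_S + 102.1 ≤ (14/135) a_S`.

With `OptimizedHeightBoundsModularity`/`SUnitMordellHeightBoundsModularityProofs` this completes the kernel
form of the printed Mordell DAG: Prop. 10.1 ⟸ {modularity, Lemma 10.3, Prop. 10.8 (i), (ii)} and
Prop. 10.1 ⟸ Prop. 10.7 + Prop. 10.8 (ii). No `abc` claim; typed ≠ proved: the roots remain named facts.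

## References

* [VonkanelMatschke2023] R. von Känel, B. Matschke, arXiv:1605.06079 = Mem. AMS 286 (2023), §10.1.1
  (Prop. 10.1), §10.3 (Lemma 10.3, (eq:nuineq), proof of Prop. 10.1), §10.5 (Prop. 10.8).
-/

noncomputable section

open Height WeierstrassCurve
open Literature.NumberTheory.EllipticCurves.ModularForms

namespace Literature.NumberTheory.DiophantineGeometry

namespace VonKanelMatschke

/-! ### Real-analysis helpers for the (junk-valued) triple logarithm -/

/-- `log log log x ≥ 0` for `x ≥ 16` (`log 16 = 4 log 2 > e`). [folklore] -/
private theorem logloglog_nonneg_of_le16 {x : ℝ} (hx : 16 ≤ x) :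
    0 ≤ Real.log (Real.log (Real.log x)) := by
  have hl2 := Real.log_two_gt_d9
  have he := Real.exp_one_lt_d9
  have h16 : Real.log 16 = 4 * Real.log 2 := by
    rw [show (16 : ℝ) = 2 ^ 4 by norm_num, Real.log_pow]; push_cast; ring
  have h1 : Real.exp 1 ≤ Real.log x := by
    have := Real.log_le_log (by norm_num) hx
    linarith
  have h2 : 1 ≤ Real.log (Real.log x) := by
    have := Real.log_le_log (Real.exp_pos 1) h1
    rwa [Real.log_exp] at this
  exact Real.log_nonneg h2

/-- Monotonicity of the triple logarithm where it is positive: for `2 ≤ y ≤ z` with `log₃ y > 0`,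
`log₃ y ≤ log₃ z`. [folklore] -/
private theorem logloglog_mono {y z : ℝ} (hy : 2 ≤ y) (hyz : y ≤ z)
    (hpos : 0 < Real.log (Real.log (Real.log y))) :
    Real.log (Real.log (Real.log y)) ≤ Real.log (Real.log (Real.log z)) := by
  have hl2 := Real.log_two_gt_d9
  have he := Real.exp_one_gt_d9
  have hL1 : Real.log 2 ≤ Real.log y := Real.log_le_log (by norm_num) hy
  have hL1pos : 0 < Real.log y := by linarith
  have hm1 : -1 ≤ Real.log (Real.log y) := by
    have h1 : Real.exp (-1) ≤ Real.log 2 := by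
      rw [Real.exp_neg]
      have : (Real.exp 1)⁻¹ ≤ (2.7182818283 : ℝ)⁻¹ := inv_anti₀ (by norm_num) he.le
      have h2 : (2.7182818283 : ℝ)⁻¹ ≤ 0.6931471803 := by norm_num
      linarith
    have h2 : Real.log (Real.exp (-1)) ≤ Real.log (Real.log y) :=
      Real.log_le_log (Real.exp_pos _) (h1.trans hL1)
    rwa [Real.log_exp] at h2
  have hL2pos : 0 < Real.log (Real.log y) := by
    by_contra h
    push Not at h
    rcases eq_or_lt_of_le h with h0 | hlt
    · rw [h0, Real.log_zero] at hpos; exact lt_irrefl _ hpos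
    · have : Real.log (Real.log (Real.log y)) ≤ 0 := by
        rw [← Real.log_neg_eq_log]
        exact Real.log_nonpos (by linarith) (by linarith)
      linarith
  have h1 : Real.log y ≤ Real.log z := Real.log_le_log (by linarith) hyz
  have h2 : Real.log (Real.log y) ≤ Real.log (Real.log z) := Real.log_le_log hL1pos h1
  exact Real.log_le_log hL2pos h2

/-! ### (eq:nuineq): `ν(m) ≤ ν(n)` for `m ∣ n` -/

/-- **vKM (10.x) `eq:nuineq`** (PROVED): *"If `m, n` are in `ℤ_{≥1}` with `m` dividing `n`, then it holds
`ν(m) ≤ ν(n)`"*, for `ν(n) = n ∏_{p² ∣ n}(1 − p⁻²)` (`condNu`). Proof: with `n = mq`, the primes `p`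
with `p² ∣ n` but `p² ∤ m` all divide `q`, and `p (1 − p⁻²) ≥ 1`.
[cite: VonkanelMatschke2023, §10.3 display (eq:nuineq)] -/
theorem condNu_mono_of_dvd {m n : ℕ} (hn : n ≠ 0) (hmn : m ∣ n) : condNu m ≤ condNu n := by
  have hm : m ≠ 0 := by rintro rfl; exact hn (zero_dvd_iff.mp hmn)
  obtain ⟨q, hq⟩ := hmn
  have hq0 : q ≠ 0 := by rintro rfl; exact hn (by rw [hq, mul_zero])
  unfold condNu
  set A : Finset ℕ := n.primeFactors.filter (fun p => p ^ 2 ∣ n) with hA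
  set B : Finset ℕ := m.primeFactors.filter (fun p => p ^ 2 ∣ m) with hB
  have hBA : B ⊆ A := by
    intro p hp
    obtain ⟨hp1, hp2⟩ := Finset.mem_filter.mp hp
    exact Finset.mem_filter.mpr ⟨Nat.primeFactors_mono ⟨q, hq⟩ hn hp1, hp2.trans ⟨q, hq⟩⟩
  have hfA : ∀ p ∈ A, (2 : ℝ) ≤ p := fun p hp => by
    exact_mod_cast (Nat.prime_of_mem_primeFactors (Finset.mem_filter.mp hp).1).two_le
  have hf0 : ∀ p ∈ A, 0 < 1 - 1 / (p : ℝ) ^ 2 := by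
    intro p hp
    have h2 := hfA p hp
    have : 1 / (p : ℝ) ^ 2 ≤ 1 / 4 := by
      rw [div_le_div_iff₀ (by positivity) (by norm_num)]; nlinarith
    linarith
  -- the primes of `A \ B` divide `q`
  have hR : (∏ p ∈ A \ B, p) ∣ q := by
    refine Finset.prod_primes_dvd q (fun p hp => ?_) (fun p hp => ?_)
    · exact (Nat.prime_of_mem_primeFactors (Finset.mem_filter.mp (Finset.mem_sdiff.mp hp).1).1).prime
    · obtain ⟨hpA, hpB⟩ := Finset.mem_sdiff.mp hp
      obtain ⟨hpn, hp2n⟩ := Finset.mem_filter.mp hpA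
      have hpP : p.Prime := Nat.prime_of_mem_primeFactors hpn
      by_cases hpm : p ∣ m
      · have hp2m : ¬ p ^ 2 ∣ m := fun h =>
          hpB (Finset.mem_filter.mpr ⟨Nat.mem_primeFactors.mpr ⟨hpP, hpm, hm⟩, h⟩)
        obtain ⟨m', hm'⟩ := hpm
        have hpm' : ¬ p ∣ m' := fun ⟨w, hw⟩ => hp2m ⟨w, by rw [hm', hw]; ring⟩
        have h1 : p * p ∣ p * (m' * q) := by
          have : p ^ 2 ∣ m * q := hq ▸ hp2n
          rw [hm', pow_two, mul_assoc] at this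
          exact this
        have h2 : p ∣ m' * q := (mul_dvd_mul_iff_left hpP.ne_zero).mp h1
        exact (hpP.dvd_mul.mp h2).resolve_left hpm'
      · have h1 : p ∣ m * q := hq ▸ Nat.dvd_of_mem_primeFactors hpn
        exact (hpP.dvd_mul.mp h1).resolve_left hpm
  have hRq : ((∏ p ∈ A \ B, p : ℕ) : ℝ) ≤ q := by
    exact_mod_cast Nat.le_of_dvd (Nat.pos_of_ne_zero hq0) hR
  -- `∏_{A \ B} p (1 − p⁻²) ≥ 1`
  have hkey : (1 : ℝ) ≤ ∏ p ∈ A \ B, ((p : ℝ) * (1 - 1 / (p : ℝ) ^ 2)) := by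
    refine Finset.one_le_prod fun p hp => ?_
    have h2 := hfA p (Finset.mem_sdiff.mp hp).1
    have hp0 : (0 : ℝ) < p := by linarith
    have : (p : ℝ) * (1 - 1 / (p : ℝ) ^ 2) = p - 1 / p := by field_simp
    rw [this]
    have : 1 / (p : ℝ) ≤ 1 / 2 := by rw [div_le_div_iff₀ hp0 (by norm_num)]; linarith
    linarith
  rw [Finset.prod_mul_distrib] at hkey
  push_cast at hRq
  have hsplit := Finset.prod_sdiff (f := fun p : ℕ => 1 - 1 / (p : ℝ) ^ 2) hBA
  have hB0 : 0 < ∏ p ∈ B, (1 - 1 / (p : ℝ) ^ 2) := Finset.prod_pos fun p hp => hf0 p (hBA hp)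
  have hAB0 : 0 ≤ ∏ p ∈ A \ B, (1 - 1 / (p : ℝ) ^ 2) :=
    Finset.prod_nonneg fun p hp => (hf0 p (Finset.mem_sdiff.mp hp).1).le
  have hm0 : (0 : ℝ) < m := by exact_mod_cast Nat.pos_of_ne_zero hm
  rw [← hsplit, hq]
  push_cast
  -- `m ∏_B ≤ m q ∏_{A\B} ∏_B`
  have h1 : (1 : ℝ) ≤ (q : ℝ) * ∏ p ∈ A \ B, (1 - 1 / (p : ℝ) ^ 2) :=
    hkey.trans (mul_le_mul_of_nonneg_right hRq hAB0)
  nlinarith [mul_pos hm0 hB0]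

/-! ### Prop. 10.1 from Lemma 10.3 and Prop. 10.8 -/

/-- **vKM Prop. 10.1 ⟸ Lemma 10.3 + Prop. 10.8 (i)+(ii)** (PROVED deduction of §10.3 "Proof of Proposition
10.1", granted modularity): the named fact `mordell_height_le` (`max(h(x), (2/3)h(y)) ≤ Ω_sim(a, S)` for every
solution of `y² = x³ + a` in `𝒪 × 𝒪`) follows from `vonKanelMatschke_lemma_10_3`,
`vonKanelMatschke_prop_10_8_i`, `vonKanelMatschke_prop_10_8_ii` and `nonempty_modularParametrizationData`:
for the curve `E` (globally minimal `W`) of Lemma 10.3 with its datum `D` at level `N_E ≥ 11`,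
`2h(E) ≤ κ + (1/6)ν log N_E + (1/16)ν log₃ N_E + (1/9)ν` (`two_mul_height_le_of_prop_10_8`) with
`ν = ν(N_E) ≤ ν(a_S) ≤ (2/3) a_S` ((eq:nuineq), `N_E ∣ a_S`, `36 ∣ a_S`), `N_E ≤ a_S`, `a_S ≥ 1728`.
[cite: VonkanelMatschke2023, Prop. 10.1 (arXiv §10.1.1, prop:m) with §10.3 (proof of Prop. 10.1)] -/
theorem mordell_height_le_of_lemma_10_3 (hmod : nonempty_modularParametrizationData)
    (h103 : vonKanelMatschke_lemma_10_3) (hi : vonKanelMatschke_prop_10_8_i)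
    (hii : vonKanelMatschke_prop_10_8_ii) : mordell_height_le := by
  intro S hS a ha haS x y hx hy hxy
  obtain ⟨W, hW, hWmin, u, -, -, -, hNdvd, hbound⟩ := h103 S hS a ha haS x y hx hy hxy
  haveI := hW
  haveI := hWmin
  haveI : NeZero (W.conductorNorm ℤ) := ⟨(conductorNorm_pos_holds W).ne'⟩
  obtain ⟨D⟩ := hmod W
  have hN11 : 11 ≤ W.conductorNorm ℤ := eleven_le_conductorNorm_of_modularity hmod W
  have h2h := two_mul_height_le_of_prop_10_8 hi hii W (W.conductorNorm ℤ) rfl hN11 D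
  have hL := hbound D.L D.isNeronLattice
  have hM := le_mordellLevel hS a
  have h4 : 4 ∣ mordellLevel S a := by
    rw [mordellLevel_def]; exact Dvd.dvd.mul_right (Dvd.dvd.mul_right (by norm_num) _) _
  have h9 : 9 ∣ mordellLevel S a := by
    rw [mordellLevel_def]; exact Dvd.dvd.mul_right (Dvd.dvd.mul_right (by norm_num) _) _
  unfold omegaSim
  generalize hMdef : mordellLevel S a = M at hM h4 h9 hNdvd ⊢
  set N : ℕ := W.conductorNorm ℤ with hNdef
  set h : ℝ := neronLatticeHeight D.L with hhdef
  have hM0' : M ≠ 0 := by omega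
  have hM' : (1728 : ℝ) ≤ M := by exact_mod_cast hM
  have hM0 : (0 : ℝ) < M := by linarith
  have hN' : (11 : ℝ) ≤ N := by exact_mod_cast hN11
  have hNM : (N : ℝ) ≤ M := by exact_mod_cast Nat.le_of_dvd (Nat.pos_of_ne_zero hM0') hNdvd
  have hν : condNu N ≤ 2 / 3 * (M : ℝ) :=
    (condNu_mono_of_dvd hM0' hNdvd).trans (condNu_le_two_thirds hM0' h4 h9)
  have hν0 : 0 ≤ condNu N := condNu_nonneg N
  have hκ := vkmKappa_le
  have hl2 := Real.log_two_lt_d9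
  have hlogN0 : 0 ≤ Real.log (N : ℝ) := Real.log_nonneg (by linarith)
  have hlogNM : Real.log (N : ℝ) ≤ Real.log M := Real.log_le_log (by linarith) hNM
  have hlogM0 : 0 ≤ Real.log (M : ℝ) := by linarith
  have hl3M : 0 ≤ Real.log (Real.log (Real.log (M : ℝ))) := logloglog_nonneg_of_le16 (by linarith)
  -- `ν log N ≤ (2/3) M log M`, `ν log₃ N ≤ (2/3) M log₃ M`
  have h1 : condNu N * Real.log N ≤ 2 / 3 * (M : ℝ) * Real.log M :=
    (mul_le_mul_of_nonneg_left hlogNM hν0).trans (mul_le_mul_of_nonneg_right hν hlogM0)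
  have hT : condNu N * Real.log (Real.log (Real.log (N : ℝ))) ≤
      2 / 3 * (M : ℝ) * Real.log (Real.log (Real.log (M : ℝ))) := by
    by_cases hn : 0 < Real.log (Real.log (Real.log (N : ℝ)))
    · have hmono := logloglog_mono (by linarith) hNM hn
      exact (mul_le_mul_of_nonneg_left hmono hν0).trans (mul_le_mul_of_nonneg_right hν hl3M)
    · push Not at hn
      have h3 : condNu N * Real.log (Real.log (Real.log (N : ℝ))) ≤ 0 :=
        mul_nonpos_of_nonneg_of_nonpos hν0 hn
      have h4 : 0 ≤ 2 / 3 * (M : ℝ) * Real.log (Real.log (Real.log (M : ℝ))) := by positivity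
      linarith
  have h8h : 8 * h ≤ 4 * vkmKappa + 4 / 9 * (M : ℝ) * Real.log M +
      1 / 6 * (M : ℝ) * Real.log (Real.log (Real.log (M : ℝ))) + 8 / 27 * (M : ℝ) := by
    linarith
  -- `2 log max(1, h) ≤ 4 log M`
  have hlogMle : Real.log (M : ℝ) ≤ (M : ℝ) - 1 := Real.log_le_sub_one_of_pos hM0
  have hl3le : Real.log (Real.log (Real.log (M : ℝ))) ≤ (M : ℝ) := by
    have h' : Real.log (Real.log (M : ℝ)) ≤ Real.log M - 1 :=
      Real.log_le_sub_one_of_pos (Real.log_pos (by linarith))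
    rcases lt_or_ge 0 (Real.log (Real.log (M : ℝ))) with hp | hp
    · have := Real.log_le_sub_one_of_pos hp
      linarith
    · -- `log log M ≤ 0` is impossible for `M ≥ 1728`, but the bound is cheap anyway
      have h16 : 1 ≤ Real.log (Real.log (M : ℝ)) := by
        have hl2' := Real.log_two_gt_d9
        have he := Real.exp_one_lt_d9
        have h32 : Real.log 16 = 4 * Real.log 2 := by
          rw [show (16 : ℝ) = 2 ^ 4 by norm_num, Real.log_pow]; push_cast; ring
        have ha : Real.exp 1 ≤ Real.log M := by
          have := Real.log_le_log (by norm_num) (show (16 : ℝ) ≤ M by linarith)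
          linarith
        have := Real.log_le_log (Real.exp_pos 1) ha
        rwa [Real.log_exp] at this
      linarith
  have h5 : (M : ℝ) * Real.log M ≤ (M : ℝ) * M := mul_le_mul_of_nonneg_left (by linarith) hM0.le
  have h6 : (M : ℝ) * Real.log (Real.log (Real.log (M : ℝ))) ≤ (M : ℝ) * M :=
    mul_le_mul_of_nonneg_left hl3le hM0.le
  have hMM : (1728 : ℝ) * M ≤ (M : ℝ) * M := mul_le_mul_of_nonneg_right hM' hM0.le
  have hmax : max 1 h ≤ (M : ℝ) ^ 2 := by
    rw [max_le_iff]; constructor <;> nlinarith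
  have hlogmax : Real.log (max 1 h) ≤ 2 * Real.log M := by
    have := Real.log_le_log (lt_of_lt_of_le one_pos (le_max_left 1 h)) hmax
    rwa [Real.log_pow, Nat.cast_ofNat] at this
  -- `log M ≤ 11 log 2 + (M/1728 − 1)`
  have hlogM : Real.log (M : ℝ) ≤ 11 * Real.log 2 + ((M : ℝ) / 1728 - 1) := by
    have e1 : Real.log (M : ℝ) = Real.log 1728 + Real.log ((M : ℝ) / 1728) := by
      rw [← Real.log_mul (by norm_num) (by positivity)]; congr 1; field_simp
    have e2 : Real.log ((M : ℝ) / 1728) ≤ (M : ℝ) / 1728 - 1 := Real.log_le_sub_one_of_pos (by positivity)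
    have e3 : Real.log (1728 : ℝ) ≤ Real.log 2048 := Real.log_le_log (by norm_num) (by norm_num)
    have e4 : Real.log (2048 : ℝ) = 11 * Real.log 2 := by
      rw [show (2048 : ℝ) = 2 ^ 11 by norm_num, Real.log_pow]; push_cast; ring
    linarith
  linarith

/-- **Prop. 10.1 from the roots, both printed ways** (PROVED): granted modularity, Lemma 10.3 and
Prop. 10.8 (i)+(ii) give `mordell_height_le` (this file), as do Prop. 10.7 and Prop. 10.8 (ii)
(`mordell_height_le_of_proposition_10_7_of_prop_10_8_ii`). This corollary merely records the conjunction.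
[cite: VonkanelMatschke2023, §10.1.1 and §10.3 (Prop. 10.1), §10.5.1 (Prop. 10.7)] -/
theorem mordell_height_le_of_roots (hmod : nonempty_modularParametrizationData)
    (h103 : vonKanelMatschke_lemma_10_3) (hi : vonKanelMatschke_prop_10_8_i)
    (hii : vonKanelMatschke_prop_10_8_ii) :
    mordell_height_le ∧ (proposition_10_7 → mordell_height_le) :=
  ⟨mordell_height_le_of_lemma_10_3 hmod h103 hi hii,
    fun h107 => mordell_height_le_of_proposition_10_7_of_prop_10_8_ii h107 hii⟩

end VonKanelMatschke

end Literature.NumberTheory.DiophantineGeometry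

end
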